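import Summits.QuantumFields.YangMills.Theorems.UnitScaleTiltProp7HcoWOfSigmaRows
import HarnessLib

/-!
# Route `UnitScaleTilt`, crux K1 «MinimiserStabilityRegPr» (stmt-QuantumFields-19200) — ARCHITECTURE (A′) «HCOW-VIA-Σ» (★★OWNER RULING g28-№13), THE KNIT DOOR WITH GENERIC SLOTS (v3):
# `hcoW` ⇐ the Σ-rows with the gauge projector `Rr` and the averaging `Qc` of the coercive operator `Δ_a = Δx + D Rr D* + Qc* a Qc` as PARAMETERS — so the SAME door serves print's COMB pair
# (`R(U₀)`, `Q_k(U₀)`: [B9] Thm 3.11 LITERALLY; slice row inhabited from `IsLandau138`∕`IsLandauPrint`) and the symmetric pair (`R_S`, `Q_k` of ✓`laplaceA`; slice row from `IsLandauPrintS`)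

Cell `ym3-torus` ∕ fleet seat `ym-ust-19200-p1` (gen 17, route-R E′ lead ∕ namer).  THEOREMS ONLY (0 `def`, 0 `sorry`); `--supports stmt-QuantumFields-19200`, count-neutral.
YM₃ on T³ is a ladder rung (R3), not the Clay problem; nothing here claims the stub, the crux, `hcoW`, HESS at the critical configuration, d = 4 or the mass gap — every row is DISPLAYED.

WHY (namer WORD 12 (S-ii), 2026-08-29).  `hcoW`'s competitor representative carries print's COMB Landau condition (`IsLandau138`), while ✓`laplaceA` carries the symmetric projector `R_S`;
until the EX namer rules which pair is of record, the door is stated over lit-balaban's abstract `laplaceAK` with `D := DL2 W`, `D* := DstarL2 W` and the projector∕averaging as slots.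
Everything else is ✓`Prop7HcoWOfSigmaRows.hcoW_of_sigmaRowsW_fam` VERBATIM (member-scaled weights); the HESS conjunct of ✓`hcoW_of_gaugedRowsW` is discharged by
✓`Prop7HessOnPrintSlice.coercive_on_landau_of_coercive` + ✓`hess_arith`.

WHAT IS PROVED (ns `…Theorems.Prop7HcoWOfSigmaRowsSlots`): ★★★ `hcoW_of_sigmaRowsW_slots`.
HONEST SCOPE.  Composition + real arithmetic over landed theorems; every analytic row is DISPLAYED; nothing of print is asserted.

References: T. Bałaban, CMP 102 (1985) 277–309 [Balaban1985Variational] ((19)–(21) p.281, (141)–(143) p.299, Prop. 7 p.299); CMP 99 (1985) 389–434 [Balaban1985BackgroundPropagators]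
((3.21)–(3.26) pp.394–395, Thm 3.11 p.416); CMP 99 (1985) 75–102 [Balaban1985RegularSpaces] ((1.38) p.82, Thm 2 p.83).
-/

set_option autoImplicit false
noncomputable section

open scoped BigOperators Matrix.Norms.L2Operator Matrix Topology InnerProductSpace
open Filter NormedSpace

namespace Summit.QuantumFields.YangMills.Theorems.Prop7HcoWOfSigmaRowsSlots

open Literature.MathematicalPhysics.QuantumFieldTheory.Balaban1983to89
open Literature.MathematicalPhysics.QuantumFieldTheory.Balaban1983to89.T3ContinuumYM3Torus
open Literature.MathematicalPhysics.QuantumFieldTheory.Balaban1983to89.T3UnitLawDensityEML (ℰp)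
open Literature.MathematicalPhysics.QuantumFieldTheory.Balaban1983to89.T3ConstrainedMinimiser (fibre)
open Literature.MathematicalPhysics.QuantumFieldTheory.Balaban1983to89.T3PrintedRegularMinimiser
open Literature.MathematicalPhysics.QuantumFieldTheory.Balaban1983to89.T3RegularMinimiser
open Literature.MathematicalPhysics.QuantumFieldTheory.Balaban1983to89.T3Thm1Carrier
open T4Continuum BlockAveraging AveragingRT ExpMeanLog BlockAveragingEMLLinearised BlockAveragingEMLLinearisedBackground BlockAveragingEMLProp2
open B10Eq27TorusAxialLog (pull)
open T3SectALandauChart (emb15 eta bgUnits)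
open B11Eq103H1Complex (BondL2K)
open Summit.QuantumFields.YangMills.Theorems.Prop7SPrint (basePt RestrictedPrint IsLandauPrintS)
open Summit.QuantumFields.YangMills.Theorems.Prop7SectET3Transport (periodsT3)
open Summit.QuantumFields.YangMills.Theorems.Prop7SectET3HilbertLetters (W₂ toL2)
open Summit.QuantumFields.YangMills.Theorems.Prop7SectET3CurvedPropagators (Qk laplaceA)
open Summit.QuantumFields.YangMills.Theorems.Prop7HcoWOfGaugedRows (hcoW_of_gaugedRowsW)
open Summit.QuantumFields.YangMills.Theorems.Prop7HessOnPrintSlice (hess_of_laplaceA_coercive_of_isLandauPrintS)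
open Summit.QuantumFields.YangMills.Theorems.Prop7HcoWOfSigmaRows (hess_arith)



/-! ## The door with generic slots -/

section DoorSlots

variable (c₀ : ℕ → ℝ) [hc₀ : ∀ L : ℕ, Fact (0 < c₀ L)] (aQ : T3Family → ℕ → ℕ → ℝ)
  (Δx : ∀ (F : T3Family) (K : ℕ), GaugeField (F.P K) 0 (Matrix.specialUnitaryGroup (Fin 2) ℂ) → (BondL2K ℂ 3 (periodsT3 F K) (c₀ F.L) W₂ →ₗ[ℂ] BondL2K ℂ 3 (periodsT3 F K) (c₀ F.L) W₂))
  (Rr : ∀ (F : T3Family) (n K : ℕ), GaugeField (F.P K) 0 (Matrix.specialUnitaryGroup (Fin 2) ℂ) → (B11Eq103H1Complex.SiteL2K ℂ 3 (periodsT3 F K) (c₀ F.L) W₂ →ₗ[ℂ] B11Eq103H1Complex.SiteL2K ℂ 3 (periodsT3 F K) (c₀ F.L) W₂))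
  {CW : ∀ (F : T3Family) (n K : ℕ), n ≤ K → Type} [hCW₁ : ∀ F n K (h : n ≤ K), NormedAddCommGroup (CW F n K h)] [hCW₂ : ∀ F n K (h : n ≤ K), InnerProductSpace ℂ (CW F n K h)]
  [hCW₃ : ∀ F n K (h : n ≤ K), FiniteDimensional ℂ (CW F n K h)]
  (Qc : ∀ (F : T3Family) (n K : ℕ) (h : n ≤ K), GaugeField (F.P K) 0 (Matrix.specialUnitaryGroup (Fin 2) ℂ) → (BondL2K ℂ 3 (periodsT3 F K) (c₀ F.L) W₂ →ₗ[ℂ] CW F n K h))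

set_option maxHeartbeats 400000 in
/-- ★★★ **`hcoW` ⇐ THE Σ-ROWS, GENERIC GAUGE-PROJECTOR AND AVERAGING SLOTS (v3; namer WORD 12 (S-ii)): the coercive operator is lit-balaban's ABSTRACT `B11Eq103H1Complex.laplaceAK (Δx W) (D_W) (Rr W) (D*_W) (Qc W) (Qc W)† a` with the projector `Rr` and the averaging `Qc` as PARAMETERS of the door (print's COMB pair `R(U₀)`, `Q_k(U₀)` — [B9] Thm 3.11 literally — or the symmetric pair `R_S`, `Q_k` of ✓`laplaceA`), and the slice row is `Rr W (D*_W X̃) = 0` (inhabited from `IsLandau138` ∕ `IsLandauPrint` for the comb `R`, from `IsLandauPrintS` for `R_S` via ✓`isLandauPrintS_iff_RS`).**  Per `L > 1`, `B₁ > 0`: radii `e₇ c₇ > 0` such that at every member, every fibre-critical `W ∈ (6)(e) ∩ 𝔅_k(V)`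
and every Thm-2 datum `(U₁ = e^{iηA}, u)` of a competitor (the `hcoW` prefix VERBATIM) there are reals `s γ cN cK cE qK qM C₁ C₂ κ` with: the sup row `‖ηA‖ ≤ s`, `4s ≤ 1`; (COERC)
`γ‖y‖² ≤ re⟪y, Δ_a(W)y⟫` for all `y` (`Δ_a = laplaceA … aQ (Δx F K) W`), `0 ≤ γ`; (LANDAU-S) `IsLandauPrintS W (ηA)`; (NORM); (SLOT); (QSMALL); `0 < cK + qK`,
`κ(cK + qK) ≤ γcN − (cE·e + qM)·ℓ⁻²`; (JOINT-Σ) the JOINT row modulo an `𝔰𝔲(2)`-valued coarse site field VERBATIM as in ✓`hcoW_of_gaugedRowsW`; windows `2eC₂ ≤ ⅛`,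
`2eC₁ℓ⁻² + 15552s² + 216·regThreshold(e) ≤ κ∕8`.  CONCLUSION = `hcoW` VERBATIM.  Proof: HESS `κ·M ≤ K` by ✓`hess_of_laplaceA_coercive_of_isLandauPrintS` + `hess_arith`, then
✓`hcoW_of_gaugedRowsW`. [cite: Balaban1985Variational, (141)-(142) p.299, Prop. 7 p.299, (19)-(21) p.281, (106)-(111) p.294; Balaban1985BackgroundPropagators, Thm 3.11 p.416, (3.10)-(3.12) p.392, (3.26) p.395; Balaban1985RegularSpaces, (1.38) p.82, Thm 2 p.83] -/
theorem hcoW_of_sigmaRowsW_slots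
    (hSig : ∀ (L : ℕ), 1 < L → ∀ (B₁ : ℝ), 0 < B₁ → ∃ e₇ c₇ : ℝ, 0 < e₇ ∧ 0 < c₇ ∧
      ∀ (F : T3Family), F.L = L → ∀ (n K : ℕ) (hnK : n < K) (e α : ℝ) (V : GaugeField (F.P n) 0 (Matrix.specialUnitaryGroup (Fin 2) ℂ))
        (W U₁ : GaugeField (F.P K) 0 (Matrix.specialUnitaryGroup (Fin 2) ℂ)) (u : GaugeTransf (F.P K) 0 (Matrix.specialUnitaryGroup (Fin 2) ℂ))
        (A : PBond (F.P K) 0 → Matrix (Fin 2) (Fin 2) ℂ),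
        0 < e → e ≤ e₇ → 0 < α → α ≤ c₇ → W ∈ regFibrePr F n K hnK.le e V →
        (∀ γ : ℝ → GaugeField (F.P K) 0 (Matrix.specialUnitaryGroup (Fin 2) ℂ), γ 0 = W → (∀ t, γ t ∈ fibre F ℰp n K hnK.le V) →
          (∀ b, DifferentiableAt ℝ (fun t => ((γ t b : Matrix.specialUnitaryGroup (Fin 2) ℂ) : Matrix (Fin 2) (Fin 2) ℂ)) 0) →
            deriv (fun t => wilsonAction4 (γ t)) 0 = 0) →
        RestrictedPrint F n K W u → (∀ b : PBond (F.P K) 0, IsSelfAdjoint (A b)) →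
        (∀ b : PBond (F.P K) 0, ((U₁ b : Matrix.specialUnitaryGroup (Fin 2) ℂ) : Matrix (Fin 2) (Fin 2) ℂ) = exp (Complex.I • ((eta F n K) • A b))) →
        (∃ (β₀ B₂ : ℝ) (len : B7Prop1Explicit.Site (F.P K).d → ℝ),
          B8Thm2TorusAt.C136T (F.P K).L (K - n) (eta F n K) β₀ B₁ B₂ len α (pull (bgUnits F K W) (basePt F n K)) (pull A (basePt F n K))) →
        B8Eq138LandauZd.IsLandau138 (F.P K).L (K - n) (eta F n K) (Set.univ : Set (B7Prop1Explicit.Site (F.P K).d)) (B8Thm4TorusAt.torusLam (K - n))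
          (pull (bgUnits F K W) (basePt F n K)) (pull A (basePt F n K)) →
        B8Thm2TorusAt.C139T (F.P K).L (K - n) (eta F n K) B₁ α (pull (bgUnits F K W) (basePt F n K)) (pull A (basePt F n K)) →
        GaugeField.gaugeAct u (emb15 W U₁) ∈ regFibrePr F n K hnK.le e V →
          ∃ s γ cN cK cE qK qM C₁ C₂ κ : ℝ, (∀ b : PBond (F.P K) 0, ‖(eta F n K • A) b‖ ≤ s) ∧ 4 * s ≤ 1 ∧
            -- (COERC) the QUANTITATIVE coercivity of print's `Δ_a(W) = Δx(W) + D R_S D* + Q_k* a Q_k` on the member's weighted `L²` space ([B9] Thm 3.11 class; N06, RULING g28-№13 (c1)–(c4))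
            (∀ y : BondL2K ℂ 3 (periodsT3 F K) (c₀ F.L) W₂, γ * ‖y‖ ^ 2 ≤ RCLike.re ⟪y, B11Eq103H1Complex.laplaceAK (Δx F K W) (Prop7SectET3HilbertLetters.DL2 F n K (c₀ F.L) W) (Rr F n K W) (Prop7SectET3HilbertLetters.DstarL2 F n K (c₀ F.L) W) (Qc F n K hnK.le W) (LinearMap.adjoint (Qc F n K hnK.le W)) (((aQ F n K : ℝ) : ℂ)) y⟫_ℂ) ∧ 0 ≤ γ ∧
            -- (LANDAU-S) the representative sits on print's slice, read with the symmetric-tube projector `R_S` (the S twin of the hypothesis `IsLandau138`)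
            Rr F n K W (Prop7SectET3HilbertLetters.DstarL2 F n K (c₀ F.L) W (toL2 F K (c₀ F.L) (eta F n K • A))) = 0 ∧
            -- (NORM) the weighted `L²` norm dominates the chart mass
            cN * (∑ b : PBond (F.P K) 0, ‖(eta F n K • A) b‖ ^ 2) ≤ ‖toL2 F K (c₀ F.L) (eta F n K • A)‖ ^ 2 ∧
            -- (SLOT) the Hessian letter is bounded above by the curl form plus an `O(e)` mass term ((3.10): `Δ = D*D + Δ′`)
            RCLike.re ⟪toL2 F K (c₀ F.L) (eta F n K • A), (Δx F K) W (toL2 F K (c₀ F.L) (eta F n K • A))⟫_ℂ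
              ≤ cK * (∑ p : Plaq (F.P K) 0, ‖((Complex.I • (eta F n K • A) ⟨p.src, p.μ⟩) + ((W ⟨p.src, p.μ⟩ : Matrix (Fin 2) (Fin 2) ℂ) * (Complex.I • (eta F n K • A) ⟨p.src.shift p.μ, p.ν⟩) * star (W ⟨p.src, p.μ⟩ : Matrix (Fin 2) (Fin 2) ℂ))
            - (((W ⟨p.src, p.μ⟩ * W ⟨p.src.shift p.μ, p.ν⟩ * (W ⟨p.src.shift p.ν, p.μ⟩)⁻¹ : Matrix.specialUnitaryGroup (Fin 2) ℂ) : Matrix (Fin 2) (Fin 2) ℂ) * (Complex.I • (eta F n K • A) ⟨p.src.shift p.ν, p.μ⟩) * star ((W ⟨p.src, p.μ⟩ * W ⟨p.src.shift p.μ, p.ν⟩ * (W ⟨p.src.shift p.ν, p.μ⟩)⁻¹ : Matrix.specialUnitaryGroup (Fin 2) ℂ) : Matrix (Fin 2) (Fin 2) ℂ))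
            - (((GaugeField.plaqHol W p : Matrix.specialUnitaryGroup (Fin 2) ℂ) : Matrix (Fin 2) (Fin 2) ℂ) * (Complex.I • (eta F n K • A) ⟨p.src, p.ν⟩) * star ((GaugeField.plaqHol W p : Matrix.specialUnitaryGroup (Fin 2) ℂ) : Matrix (Fin 2) (Fin 2) ℂ)))‖ ^ 2)
                + cE * e * (((F.L : ℝ) ^ (K - n)) ^ 2)⁻¹ * (∑ b : PBond (F.P K) 0, ‖(eta F n K • A) b‖ ^ 2) ∧
            -- (QSMALL) the averaging penalty at the representative is small (on Σ it is fourth order)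
            aQ F n K * ‖Qc F n K hnK.le W (toL2 F K (c₀ F.L) (eta F n K • A))‖ ^ 2
              ≤ qK * (∑ p : Plaq (F.P K) 0, ‖((Complex.I • (eta F n K • A) ⟨p.src, p.μ⟩) + ((W ⟨p.src, p.μ⟩ : Matrix (Fin 2) (Fin 2) ℂ) * (Complex.I • (eta F n K • A) ⟨p.src.shift p.μ, p.ν⟩) * star (W ⟨p.src, p.μ⟩ : Matrix (Fin 2) (Fin 2) ℂ))
            - (((W ⟨p.src, p.μ⟩ * W ⟨p.src.shift p.μ, p.ν⟩ * (W ⟨p.src.shift p.ν, p.μ⟩)⁻¹ : Matrix.specialUnitaryGroup (Fin 2) ℂ) : Matrix (Fin 2) (Fin 2) ℂ) * (Complex.I • (eta F n K • A) ⟨p.src.shift p.ν, p.μ⟩) * star ((W ⟨p.src, p.μ⟩ * W ⟨p.src.shift p.μ, p.ν⟩ * (W ⟨p.src.shift p.ν, p.μ⟩)⁻¹ : Matrix.specialUnitaryGroup (Fin 2) ℂ) : Matrix (Fin 2) (Fin 2) ℂ))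
            - (((GaugeField.plaqHol W p : Matrix.specialUnitaryGroup (Fin 2) ℂ) : Matrix (Fin 2) (Fin 2) ℂ) * (Complex.I • (eta F n K • A) ⟨p.src, p.ν⟩) * star ((GaugeField.plaqHol W p : Matrix.specialUnitaryGroup (Fin 2) ℂ) : Matrix (Fin 2) (Fin 2) ℂ)))‖ ^ 2)
                + qM * (((F.L : ℝ) ^ (K - n)) ^ 2)⁻¹ * (∑ b : PBond (F.P K) 0, ‖(eta F n K • A) b‖ ^ 2) ∧
            -- the HESS constant `κ` these rows deliver
            0 < cK + qK ∧ κ * (cK + qK) ≤ γ * cN - (cE * e + qM) * (((F.L : ℝ) ^ (K - n)) ^ 2)⁻¹ ∧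
            (∀ (Q : (k : ℕ) → (PBond (F.P K) 0 → Matrix (Fin 2) (Fin 2) ℂ) → PBond (F.P K) k → Matrix (Fin 2) (Fin 2) ℂ), (∀ Y, Q 0 Y = Y) →
        (∀ (k : ℕ) (Y : PBond (F.P K) 0 → Matrix (Fin 2) (Fin 2) ℂ) (c : PBond (F.P K) (k + 1)), Q (k + 1) Y c
          = fderiv ℂ (eml : (Idx (F.P K) → Matrix (Fin 2) (Fin 2) ℂ) → Matrix (Fin 2) (Fin 2) ℂ)
              (fun i => ((loopHol (Averaging.iter (fun i => blockAvg (P := F.P K) (j := i) (expMeanLogSU (n := Fin 2))) k W) c i :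
                Matrix.specialUnitaryGroup (Fin 2) ℂ) : Matrix (Fin 2) (Fin 2) ℂ))
              (fun i => covWalkSum (Averaging.iter (fun i => blockAvg (P := F.P K) (j := i) (expMeanLogSU (n := Fin 2))) k W) (Q k Y)
                  (walk (emb c.src) (loopWord (F.P K).L c.dir (off i.1) i.2.1 i.2.2))
                * ((loopHol (Averaging.iter (fun i => blockAvg (P := F.P K) (j := i) (expMeanLogSU (n := Fin 2))) k W) c i :
                  Matrix.specialUnitaryGroup (Fin 2) ℂ) : Matrix (Fin 2) (Fin 2) ℂ))
              * star ((corr (expMeanLogSU (n := Fin 2)) (Averaging.iter (fun i => blockAvg (P := F.P K) (j := i) (expMeanLogSU (n := Fin 2))) k W) c :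
                  Matrix.specialUnitaryGroup (Fin 2) ℂ) : Matrix (Fin 2) (Fin 2) ℂ)
            + ((corr (expMeanLogSU (n := Fin 2)) (Averaging.iter (fun i => blockAvg (P := F.P K) (j := i) (expMeanLogSU (n := Fin 2))) k W) c :
                  Matrix.specialUnitaryGroup (Fin 2) ℂ) : Matrix (Fin 2) (Fin 2) ℂ)
              * covWalkSum (Averaging.iter (fun i => blockAvg (P := F.P K) (j := i) (expMeanLogSU (n := Fin 2))) k W) (Q k Y)
                  (walk (emb c.src) (List.replicate (F.P K).L (c.dir, true)))
              * star ((corr (expMeanLogSU (n := Fin 2)) (Averaging.iter (fun i => blockAvg (P := F.P K) (j := i) (expMeanLogSU (n := Fin 2))) k W) c :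
                  Matrix.specialUnitaryGroup (Fin 2) ℂ) : Matrix (Fin 2) (Fin 2) ℂ)) →
            ∃ μ : Site (F.P K) (K - n) → Matrix (Fin 2) (Fin 2) ℂ, (∀ y, μ y ∈ skewAdjoint (Matrix (Fin 2) (Fin 2) ℂ) ∧ (μ y).trace = 0) ∧
            ∑ c : PBond (F.P K) (K - n), ‖Q (K - n) (fun b => Complex.I • (eta F n K • A) b) c
                - (μ c.src
                  - ((Averaging.iter (fun i => blockAvg (P := F.P K) (j := i) (expMeanLogSU (n := Fin 2))) (K - n) W c : Matrix.specialUnitaryGroup (Fin 2) ℂ) :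
                      Matrix (Fin 2) (Fin 2) ℂ) * μ c.tgt
                    * star ((Averaging.iter (fun i => blockAvg (P := F.P K) (j := i) (expMeanLogSU (n := Fin 2))) (K - n) W c : Matrix.specialUnitaryGroup (Fin 2) ℂ) :
                      Matrix (Fin 2) (Fin 2) ℂ))‖
              ≤ C₁ * ((F.L : ℝ) ^ (K - n))⁻¹ * ∑ b : PBond (F.P K) 0, ‖(eta F n K • A) b‖ ^ 2
                + C₂ * (F.L : ℝ) ^ (K - n) * ∑ p : Plaq (F.P K) 0, ‖((Complex.I • (eta F n K • A) ⟨p.src, p.μ⟩) + ((W ⟨p.src, p.μ⟩ : Matrix (Fin 2) (Fin 2) ℂ) * (Complex.I • (eta F n K • A) ⟨p.src.shift p.μ, p.ν⟩) * star (W ⟨p.src, p.μ⟩ : Matrix (Fin 2) (Fin 2) ℂ))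
            - (((W ⟨p.src, p.μ⟩ * W ⟨p.src.shift p.μ, p.ν⟩ * (W ⟨p.src.shift p.ν, p.μ⟩)⁻¹ : Matrix.specialUnitaryGroup (Fin 2) ℂ) : Matrix (Fin 2) (Fin 2) ℂ) * (Complex.I • (eta F n K • A) ⟨p.src.shift p.ν, p.μ⟩) * star ((W ⟨p.src, p.μ⟩ * W ⟨p.src.shift p.μ, p.ν⟩ * (W ⟨p.src.shift p.ν, p.μ⟩)⁻¹ : Matrix.specialUnitaryGroup (Fin 2) ℂ) : Matrix (Fin 2) (Fin 2) ℂ))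
            - (((GaugeField.plaqHol W p : Matrix.specialUnitaryGroup (Fin 2) ℂ) : Matrix (Fin 2) (Fin 2) ℂ) * (Complex.I • (eta F n K • A) ⟨p.src, p.ν⟩) * star ((GaugeField.plaqHol W p : Matrix.specialUnitaryGroup (Fin 2) ℂ) : Matrix (Fin 2) (Fin 2) ℂ)))‖ ^ 2) ∧
            2 * e * C₂ ≤ 1 / 8 ∧
            2 * e * C₁ * (((F.L : ℝ) ^ (K - n)) ^ 2)⁻¹ + 15552 * s ^ 2 + 216 * regThreshold F n K e ≤ κ / 8) :
    ∀ (L : ℕ), 1 < L → ∀ (B₁ : ℝ), 0 < B₁ → ∃ e₇ c₇ : ℝ, 0 < e₇ ∧ 0 < c₇ ∧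
      ∀ (F : T3Family), F.L = L → ∀ (n K : ℕ) (hnK : n < K) (e α : ℝ) (V : GaugeField (F.P n) 0 (Matrix.specialUnitaryGroup (Fin 2) ℂ))
        (W U₁ : GaugeField (F.P K) 0 (Matrix.specialUnitaryGroup (Fin 2) ℂ)) (u : GaugeTransf (F.P K) 0 (Matrix.specialUnitaryGroup (Fin 2) ℂ))
        (A : PBond (F.P K) 0 → Matrix (Fin 2) (Fin 2) ℂ),
        0 < e → e ≤ e₇ → 0 < α → α ≤ c₇ → W ∈ regFibrePr F n K hnK.le e V →
        (∀ γ : ℝ → GaugeField (F.P K) 0 (Matrix.specialUnitaryGroup (Fin 2) ℂ), γ 0 = W → (∀ t, γ t ∈ fibre F ℰp n K hnK.le V) →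
          (∀ b, DifferentiableAt ℝ (fun t => ((γ t b : Matrix.specialUnitaryGroup (Fin 2) ℂ) : Matrix (Fin 2) (Fin 2) ℂ)) 0) →
            deriv (fun t => wilsonAction4 (γ t)) 0 = 0) →
        RestrictedPrint F n K W u → (∀ b : PBond (F.P K) 0, IsSelfAdjoint (A b)) →
        (∀ b : PBond (F.P K) 0, ((U₁ b : Matrix.specialUnitaryGroup (Fin 2) ℂ) : Matrix (Fin 2) (Fin 2) ℂ) = exp (Complex.I • ((eta F n K) • A b))) →
        (∃ (β₀ B₂ : ℝ) (len : B7Prop1Explicit.Site (F.P K).d → ℝ),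
          B8Thm2TorusAt.C136T (F.P K).L (K - n) (eta F n K) β₀ B₁ B₂ len α (pull (bgUnits F K W) (basePt F n K)) (pull A (basePt F n K))) →
        B8Eq138LandauZd.IsLandau138 (F.P K).L (K - n) (eta F n K) (Set.univ : Set (B7Prop1Explicit.Site (F.P K).d)) (B8Thm4TorusAt.torusLam (K - n))
          (pull (bgUnits F K W) (basePt F n K)) (pull A (basePt F n K)) →
        B8Thm2TorusAt.C139T (F.P K).L (K - n) (eta F n K) B₁ α (pull (bgUnits F K W) (basePt F n K)) (pull A (basePt F n K)) →
        GaugeField.gaugeAct u (emb15 W U₁) ∈ regFibrePr F n K hnK.le e V →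
          wilsonAction4 W ≤ wilsonAction4 (emb15 W U₁) := by
  refine hcoW_of_gaugedRowsW ?_
  intro L hL B₁ hB₁
  obtain ⟨e₇, c₇, he₇, hc₇, H⟩ := hSig L hL B₁ hB₁
  refine ⟨e₇, c₇, he₇, hc₇, ?_⟩
  intro F hF n K hnK e α V W U₁ u A he heε hα hαc hWreg hEL hRP hA hU₁ h136 h138 h139 hmem
  obtain ⟨s, γ, cN, cK, cE, qK, qM, C₁, C₂, κ, hs, hs4, hco, hγ, hLS, hN, hSl, hQ, hpos, hκ, hJ, hw1, hw2⟩ :=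
    H F hF n K hnK e α V W U₁ u A he heε hα hαc hWreg hEL hRP hA hU₁ h136 h138 h139 hmem
  refine ⟨s, κ, C₁, C₂, hs, hs4, ?_, hJ, hw1, hw2⟩
  -- HESS `κ·M ≤ K` from the Σ-rows: the gauge penalty of `Δ_a` vanishes on print's slice (✓p686677), then arithmetic
  have h1 : γ * ‖toL2 F K (c₀ F.L) (eta F n K • A)‖ ^ 2 - aQ F n K * ‖Qc F n K hnK.le W (toL2 F K (c₀ F.L) (eta F n K • A))‖ ^ 2
      ≤ RCLike.re ⟪toL2 F K (c₀ F.L) (eta F n K • A), (Δx F K) W (toL2 F K (c₀ F.L) (eta F n K • A))⟫_ℂ := by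
    have h0 := Prop7HessOnPrintSlice.coercive_on_landau_of_coercive (Δx F K W) (Prop7SectET3HilbertLetters.DL2 F n K (c₀ F.L) W) (Rr F n K W) (Prop7SectET3HilbertLetters.DstarL2 F n K (c₀ F.L) W)
      (Qc F n K hnK.le W) (LinearMap.adjoint (Qc F n K hnK.le W)) (((aQ F n K : ℝ) : ℂ)) rfl hco hLS
    have ha : RCLike.re (((aQ F n K : ℝ) : ℂ)) = aQ F n K := by simp [RCLike.re_to_complex]
    rw [ha] at h0
    exact h0
  have hM : (0 : ℝ) ≤ ∑ b : PBond (F.P K) 0, ‖(eta F n K • A) b‖ ^ 2 := Finset.sum_nonneg fun b _ => by positivity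
  exact hess_arith hM hγ h1 hN hSl hQ hpos hκ

end DoorSlots

end Summit.QuantumFields.YangMills.Theorems.Prop7HcoWOfSigmaRowsSlots

end
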